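import Summits.BirchSwinnertonDyer.BirchSwinnertonDyer.Theorems.PrintX10bJetchevSwapBridge
import Summits.BirchSwinnertonDyer.BirchSwinnertonDyer.Theorems.PrintX10bJetchevSwapOfNamedFacts
import HarnessLib

/-!
# Route `PrintX10b`, crux J₃ = `HeegnerDivisibilityX10b` (item stmt-BirchSwinnertonDyer-21340, rev 3b): the ROUTE-FREE
# GLUE — the crux body VERBATIM from ONE reading (`stub_beyondCarrierDepthX10b`, the multi-carrier / beyond-carrier-depth
# regime) + the bundle of THREE NAMED LITERATURE FACTS; the carrier-depth regime (`stub_carrierDepthX10b`, Jetchev's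
# Thm. 1.4 shape at the irreducible NON-surjective mod-3 image) is DISCHARGED in the kernel

Cell `bsd-print-x9` (print tier, key `x9`), prover seat p3 g2 on the planner's assignment (plan g3 20:01Z «J₃ TWIN of p4's
X9 Jetchev chain at p = 3 on the rev-3b frames»); `--supports stmt-BirchSwinnertonDyer-21340`; THEOREMS ONLY, no
`Theses` module imported (the planner splits 21340 `--glue-by` the second theorem below, PLAN §7(b)); nothing booked, no
item closed here, BSD is not proved by any of this.

WHAT.
* `carrierDepthX10b_of_namedFacts (h37) (hPT) (hF1)` — the registered stub `stub_carrierDepthX10b` of the birth skeleton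
  `Cruxes/HeegnerDivisibilityX10b/Lines/birth3b` (HOME/plan/x10b3/bc/HeegnerDivisibilityX10b_birth3b.lean), signature
  VERBATIM as conclusion, from the three named facts alone: the J₃ twin of p4's `JET.Split.jetchevX9_of_namedFacts`. It is
  `JET.SplitThree.carrierDepthX10b_of_swapX10b_of_namedFacts` (file `PrintX10bJetchevSwapBridge`: Thm. 5.2 at a core vertex +
  the per-level inequality + p4's generic `pDiv_of_swap_of_perLevel_lt`) fed the PROVED swap reading
  `JET.SplitThree.swapX10b_of_namedFacts` (file `PrintX10bJetchevSwapOfNamedFacts`: Kolyvagin's prime swap, McCallum 1991 §5,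
  at the X10b image on the rev-3b frames). beyond-print: YES — Jetchev 2008 Thm. 1.4 (`P_n ∈ p^s E(K[n])` for `s ≤ ord_p c_q`,
  one carrier `q`) is printed under Hypothesis (∗) (`ρ̄_(E,p)` onto) and `p ∤ 6`; here `p = 3` and the mod-3 image is a
  Cartan normaliser (irreducible, NOT onto), kernel-checked modulo the three image-free named facts.
* `heegnerDivisibilityX10b_of_multiCarrier_of_printFacts_routeFree (hMC3) (hPF)` — conclusion = the BODY of
  `Summit.BirchSwinnertonDyer.BirchSwinnertonDyer.Theses.PrintX10b.HeegnerDivisibilityX10b` (Theses/PrintX10b.lean, rev 3b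
  statement of 2026-08-27T18:00Z) VERBATIM; binders: `hMC3` = `stub_beyondCarrierDepthX10b` VERBATIM (the reading: depths
  `s` with `ord_3 c_q < s` for EVERY bad prime `q` — all 39 rank-1 X10b census pairs are multi-prime; no printed source at a
  non-surjective image, BCGS 2026 Thm. 2 being under (sur) and `p > 3`), `hPF` = the bundle
  `GrossLMS1991.prop37_2_frobeniusCongruence ∧ (∀ K, GaloisCohomology.poitouTate_selmerStructure_duality_conj K) ∧
  Gross1991_heegnerPoint_sub_ratTorsion_mem_E0_imageFree` (same three heads as the X9 glue p564241). Proof: the planner's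
  case split `HeegnerDivisibilityX10b_of` (depth carried by one prime or by none) with `h₁` discharged.

THE TWO NON-MECHANICAL SPOTS OF THE PORT (everything else is p4's X9 chain with `ClassX9 W p ↦ ClassX10 W p` and ty2's
ClassX10 dot-lemmas): (1) the (γ) supplier of the based data family in `coreVertexExistenceX10b_of_namedFacts` — at
`p = 3` Nekovář's clause `ℓ ≠ 2` comes from the rev-3b frame binder `d_K ≡ 1 (mod 8)` (ty2 file O
`Prop44.exists_data_h47Base_of_frobeniusCongruence_of_discr_mod_eight_eq_one`), not from `p ≠ 3`; (2) the swap step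
`not_dvd_of_swap_classX10b` — `ℓ ≠ 2` for Zhang–Kolyvagin primes again from the frame (ty2 file M), not from `p ≥ 5`.
Hence the binder `NumberField.discr K % 8 = 1` threads through CoreVertexExistence / SwapStep / SwapOfNamedFacts /
SwapBridge §2–§3 — exactly the rev-3b restatement of 21340. No J₃-OBSTACLE was met.

CONDITIONAL on `hMC3` and the three facts; nothing asserted about any curve.
References: [cite: Jetchev2008, Thm. 1.4 (p. 812), Thm. 5.2, Prop. 5.3, Rem. 6.2, proof of Thm. 1.1 (p. 824)]
[cite: McCallumLMS1991, §3 Cor. 3.2, §4 Prop. 4.4, §5 Prop. 5.2 (p. 304)] [cite: GrossLMS1991, Prop. 3.7 (2)]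
[cite: BurungaleEtAl2026, Thm. 2 and §2.2] [cite: GrossZagier1986, III (3.1)].
-/

set_option autoImplicit false

noncomputable section

open scoped Classical

namespace Summit.BirchSwinnertonDyer.Rank1Residual.JET.SplitThree

open WeierstrassCurve Literature.NumberTheory.EllipticCurves
  Literature.NumberTheory.EllipticCurves.ModularForms
  Literature.NumberTheory.EllipticCurves.Rank1Residual
  Literature.NumberTheory.GaloisCohomology
  Summit.BirchSwinnertonDyer.Rank1Residual Summit.BirchSwinnertonDyer.Rank1Residual.JET
  Summit.BirchSwinnertonDyer.Rank1Residual.JET.Split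

/-- **`stub_carrierDepthX10b` (crux 21340, registered signature of the birth skeleton 3b VERBATIM) from THREE NAMED
LITERATURE FACTS** {Gross 1991 Prop. 3.7 (2), Poitou–Tate for Selmer structures, [GZ86 III (3.1)] image-free}: the
carrier-depth regime of J₃ at `p = 3` — on every X10b Heegner frame of rev 3b (`|d_K| > 4`, `d_K ≡ 1 (mod 8)`) every
derived Heegner point over Zhang–Kolyvagin conductors of index `≥ s` is `3^s`-divisible whenever ONE bad prime `q` has
`s ≤ ord_3 c_q(E)`. `carrierDepthX10b_of_swapX10b_of_namedFacts` ∘ `swapX10b_of_namedFacts`. CONDITIONAL on the three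
facts; nothing asserted. [cite: Jetchev2008, Thm. 1.4 (p. 812), proof of Thm. 1.1 (p. 824)] [cite: McCallumLMS1991, §5 Prop. 5.2 (p. 304)] -/
theorem carrierDepthX10b_of_namedFacts
    (h37 : GrossLMS1991.prop37_2_frobeniusCongruence)
    (hPT : ∀ (K : Type) [Field K] [NumberField K], poitouTate_selmerStructure_duality_conj K)
    (hF1 : Gross1991_heegnerPoint_sub_ratTorsion_mem_E0_imageFree) :
    ∀ (W : WeierstrassCurve ℚ) [W.IsElliptic] [W.IsGloballyMinimal] [NeZero (W.conductorNorm ℤ)] (p : ℕ) [Fact p.Prime], Literature.NumberTheory.EllipticCurves.Rank1Residual.ClassX10 W p → ¬ Literature.NumberTheory.EllipticCurves.Rank1Residual.Surj W 3 → ¬ W.HasCM → W.analyticRank = 1 → ∃ B : ℕ, ∀ (K : Type) [Field K] [NumberField K] (Dt : Literature.NumberTheory.EllipticCurves.ModularForms.ModularParametrizationData W (W.conductorNorm ℤ)) (β : ℤ) (ι : K →+* ℂ), Literature.NumberTheory.EllipticCurves.IsImaginaryQuadratic K → B < (NumberField.discr K).natAbs → NumberField.discr K % 8 = 1 → Literature.NumberTheory.EllipticCurves.SatisfiesHeegnerHypothesis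 (W.conductorNorm ℤ) K → Literature.NumberTheory.EllipticCurves.SatisfiesHeegnerHypothesis p K → (4 * (W.conductorNorm ℤ : ℤ)) ∣ β ^ 2 - NumberField.discr K → ¬ (p : ℤ) ∣ Dt.c → ∀ (d₁ : Literature.NumberTheory.EllipticCurves.KolyvaginHeegnerData Dt β ι 1), ¬ IsOfFinAddOrder d₁.derivedPoint → ∀ (s : ℕ), (∃ (q : ℕ) (_ : Fact q.Prime), q ∣ W.conductorNorm ℤ ∧ s ≤ padicValNat p ((W.baseChange ℚ_[q]).localTamagawaNumber ℤ_[q])) → s ≤ padicValNat p W.tamagawaProduct → ∀ (n : ℕ) (d : Literature.NumberTheory.EllipticCurves.KolyvaginHeegnerData Dt β ι n), Squarefree n → (∀ ℓ ∈ n.primeFactors, Literature.NumberTheory.EllipticCurves.Zhang2014.IsKolyvaginPrime (W.conductorNorm ℤ) W K p ℓ ∧ s ≤ Literature.NumberTheory.EllipticCurves.Zhang2014.kolyvaginIndex W p ℓ) → ∃ Q : (W.baseChange (Literature.NumberTheory.EllipticCurves.ringClassField K ι n)).toAffine.Point, ((p ^ s : ℕ) : ℤ) • Q = d.derivedPoint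 :=
  carrierDepthX10b_of_swapX10b_of_namedFacts (swapX10b_of_namedFacts h37 hPT hF1) h37 hPT hF1

/-- **Crux J₃ `HeegnerDivisibilityX10b` (item 21340, rev 3b) — the route decl's BODY VERBATIM — from the reading
`stub_beyondCarrierDepthX10b` (`hMC3`, the multi-carrier regime: depths beyond every single carrier) and the bundle `hPF` of
the three named Literature facts; ROUTE-FREE glue for the planner's `--split … --glue-by`.** By cases on whether some bad
prime `q ∣ N_E` carries the depth `s` (`s ≤ ord_3 c_q`): yes — `carrierDepthX10b_of_namedFacts` (kernel modulo the facts);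
no — the reading `hMC3`. `B := max B₁ B₂`. CONDITIONAL on `hMC3` and the facts; nothing asserted.
[cite: Jetchev2008, Thm. 1.4 (p. 812)] [cite: BurungaleEtAl2026, Thm. 2 and §2.2] [cite: McCallumLMS1991, §5 Prop. 5.2 (p. 304)] -/
theorem heegnerDivisibilityX10b_of_multiCarrier_of_printFacts_routeFree
    (hMC3 : ∀ (W : WeierstrassCurve ℚ) [W.IsElliptic] [W.IsGloballyMinimal] [NeZero (W.conductorNorm ℤ)] (p : ℕ) [Fact p.Prime], Literature.NumberTheory.EllipticCurves.Rank1Residual.ClassX10 W p → ¬ Literature.NumberTheory.EllipticCurves.Rank1Residual.Surj W 3 → ¬ W.HasCM → W.analyticRank = 1 → ∃ B : ℕ, ∀ (K : Type) [Field K] [NumberField K] (Dt : Literature.NumberTheory.EllipticCurves.ModularForms.ModularParametrizationData W (W.conductorNorm ℤ)) (β : ℤ) (ι : K →+* ℂ), Literature.NumberTheory.EllipticCurves.IsImaginaryQuadratic K → B < (NumberField.discr K).natAbs → NumberField.discr K % 8 = 1 → Literature.NumberTheory.EllipticCurves.SatisfiesHeegnerHypothesis (W.conductorNorm ℤ) K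 → Literature.NumberTheory.EllipticCurves.SatisfiesHeegnerHypothesis p K → (4 * (W.conductorNorm ℤ : ℤ)) ∣ β ^ 2 - NumberField.discr K → ¬ (p : ℤ) ∣ Dt.c → ∀ (d₁ : Literature.NumberTheory.EllipticCurves.KolyvaginHeegnerData Dt β ι 1), ¬ IsOfFinAddOrder d₁.derivedPoint → ∀ (s : ℕ), (∀ (q : ℕ) [Fact q.Prime], q ∣ W.conductorNorm ℤ → padicValNat p ((W.baseChange ℚ_[q]).localTamagawaNumber ℤ_[q]) < s) → s ≤ padicValNat p W.tamagawaProduct → ∀ (n : ℕ) (d : Literature.NumberTheory.EllipticCurves.KolyvaginHeegnerData Dt β ι n), Squarefree n → (∀ ℓ ∈ n.primeFactors, Literature.NumberTheory.EllipticCurves.Zhang2014.IsKolyvaginPrime (W.conductorNorm ℤ) W K p ℓ ∧ s ≤ Literature.NumberTheory.EllipticCurves.Zhang2014.kolyvaginIndex W p ℓ) → ∃ Q : (W.baseChange (Literature.NumberTheory.EllipticCurves.ringClassField K ι n)).toAffine.Point, ((p ^ s : ℕ) : ℤ) • Q = d.derivedPoint)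
    (hPF : Literature.NumberTheory.EllipticCurves.GrossLMS1991.prop37_2_frobeniusCongruence ∧
      (∀ (K : Type) [Field K] [NumberField K],
        Literature.NumberTheory.GaloisCohomology.poitouTate_selmerStructure_duality_conj K) ∧
      Literature.NumberTheory.EllipticCurves.Gross1991_heegnerPoint_sub_ratTorsion_mem_E0_imageFree) :
    ∀ (W : WeierstrassCurve ℚ) [W.IsElliptic] [W.IsGloballyMinimal] [NeZero (W.conductorNorm ℤ)] (p : ℕ) [Fact p.Prime], Literature.NumberTheory.EllipticCurves.Rank1Residual.ClassX10 W p → ¬ Literature.NumberTheory.EllipticCurves.Rank1Residual.Surj W 3 → ¬ W.HasCM → W.analyticRank = 1 → ∃ B : ℕ, ∀ (K : Type) [Field K] [NumberField K] (Dt : Literature.NumberTheory.EllipticCurves.ModularForms.ModularParametrizationData W (W.conductorNorm ℤ)) (β : ℤ) (ι : K →+* ℂ), Literature.NumberTheory.EllipticCurves.IsImaginaryQuadratic K → B < (NumberField.discr K).natAbs → NumberField.discr K % 8 = 1 → Literature.NumberTheory.EllipticCurves.SatisfiesHeegnerHypothesis (W.conductorNorm ℤ) K → Literature.NumberTheory.EllipticCurves.SatisfiesHeegnerHypothesis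 p K → (4 * (W.conductorNorm ℤ : ℤ)) ∣ β ^ 2 - NumberField.discr K → ¬ (p : ℤ) ∣ Dt.c → ∀ (d₁ : Literature.NumberTheory.EllipticCurves.KolyvaginHeegnerData Dt β ι 1), ¬ IsOfFinAddOrder d₁.derivedPoint → ∀ (s : ℕ), s ≤ padicValNat p W.tamagawaProduct → ∀ (n : ℕ) (d : Literature.NumberTheory.EllipticCurves.KolyvaginHeegnerData Dt β ι n), Squarefree n → (∀ ℓ ∈ n.primeFactors, Literature.NumberTheory.EllipticCurves.Zhang2014.IsKolyvaginPrime (W.conductorNorm ℤ) W K p ℓ ∧ s ≤ Literature.NumberTheory.EllipticCurves.Zhang2014.kolyvaginIndex W p ℓ) → ∃ Q : (W.baseChange (Literature.NumberTheory.EllipticCurves.ringClassField K ι n)).toAffine.Point, ((p ^ s : ℕ) : ℤ) • Q = d.derivedPoint := by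
  intro W _ _ _ p _ hX hns hcm hr
  obtain ⟨B₁, hB₁⟩ := carrierDepthX10b_of_namedFacts hPF.1 hPF.2.1 hPF.2.2 W p hX hns hcm hr
  obtain ⟨B₂, hB₂⟩ := hMC3 W p hX hns hcm hr
  refine ⟨max B₁ B₂, ?_⟩
  intro K _ _ Dt β ι hK hBK hd8 hH hHp hβ hc d₁ hd₁ s hs n d hn hℓ
  by_cases hC : (∃ (q : ℕ) (_ : Fact q.Prime), q ∣ W.conductorNorm ℤ ∧
      s ≤ padicValNat p ((W.baseChange ℚ_[q]).localTamagawaNumber ℤ_[q]))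
  · exact hB₁ K Dt β ι hK (lt_of_le_of_lt (le_max_left _ _) hBK) hd8 hH hHp hβ hc d₁ hd₁ s hC hs n d hn hℓ
  · refine hB₂ K Dt β ι hK (lt_of_le_of_lt (le_max_right _ _) hBK) hd8 hH hHp hβ hc d₁ hd₁ s ?_ hs n d hn hℓ
    intro q hq hqN
    by_contra hlt
    exact hC ⟨q, hq, hqN, by omega⟩

end Summit.BirchSwinnertonDyer.Rank1Residual.JET.SplitThree

end
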